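import Mathlib.MeasureTheory.Integral.IntervalIntegral.IntegrationByParts
import Mathlib.MeasureTheory.Integral.IntervalIntegral.FundThmCalculus
import Mathlib.Analysis.Calculus.MeanValue
import Mathlib.Analysis.Calculus.Deriv.Pow
import HarnessLib

/-!
# Pushforward estimates for the far-field expansion against a test function (STUB C, part C1)

Crux `…Theses.CardyUniqueLimit.CardyRigidity` (stmt-CriticalPhenomena-0746), line
`crossing_martingale`, STUB C `stub_kernelAffineBeta`.  The probabilistic half C1 of STUB C (a
regular crossing-martingale driver of a continuous kernel `f` satisfies
`HasFarFieldIdentities f (E W₁²)`, see `…FarFieldBase`) integrates the martingale identity against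
a test function `ψ(θ)` of the translation parameter of the marks and expands at order `R⁻²`; as
`f` is merely continuous, every perturbation of the argument is pushed onto `ψ`.  Tools (for `F`
continuous and bounded on a window, WITHOUT inverting the perturbed map `θ ↦ θ + λ θ`):
`Pushforward.integral_comp_perturb_mul_deriv` (substitution core),
`Pushforward.integral_comp_perturb_sub_le` (first order, `‖λ‖_{C¹} ≤ ε`),
`Pushforward.integral_comp_perturb_sub_second_le` (second order, `‖λ‖_{C³} ≤ ε`; registered glue
sub-goal `pushforward_second_order`), `Pushforward.integral_shift` (`∫ F(θ-w)ψ(θ) = ∫ F(θ)ψ(θ+w)`)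
and the Taylor bounds `Pushforward.taylor_shift_bound`, `Pushforward.taylor_one_bound`.
In C1: `w = W₁/R`, the `O(R⁻²)` Loewner drift of the modulus is `λ = (2/R²) k̂` in modulus
coordinates (second order), the `O(R⁻³)` random remainder goes through the first-order lemma.
-/

noncomputable section

open MeasureTheory Filter Set Topology

namespace Summit.CriticalPhenomena.CardyFormulaZ2.Cruxes.CardyRigidity.CrossingMartingale

namespace Pushforward

/-- Mean value inequality on `ℝ` for an everywhere differentiable function with bounded
derivative. [folklore] -/
theorem abs_sub_le_of_deriv_bound {g g' : ℝ → ℝ} {C : ℝ} (hg : ∀ x, HasDerivAt g (g' x) x)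
    (hC : ∀ x, |g' x| ≤ C) (x y : ℝ) : |g y - g x| ≤ C * |y - x| := by
  have := Convex.norm_image_sub_le_of_norm_hasDerivWithin_le (s := univ) (f := g) (f' := g')
    (fun x _ ↦ (hg x).hasDerivWithinAt) (fun x _ ↦ by simpa [Real.norm_eq_abs] using hC x)
    convex_univ (mem_univ x) (mem_univ y)
  simpa [Real.norm_eq_abs] using this

/-- **Substitution core.** For `T = id + λ` (`|λ| ≤ 1`, `λ ∈ C¹`) and `g` continuous on
`[a-1, b+1]` vanishing on `(-∞, a+ε] ∪ [b-ε, ∞)` with `|λ| ≤ ε`: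
`∫ₐᵇ g(Tθ) T'(θ) dθ = ∫ₐᵇ g`. [folklore] -/
theorem integral_comp_perturb_mul_deriv {g lam lam' : ℝ → ℝ} {a b ε : ℝ} (hab : a ≤ b)
    (hε1 : ε ≤ 1) (hg : ContinuousOn g (Icc (a - 1) (b + 1)))
    (hgs : ∀ u, u ≤ a + ε ∨ b - ε ≤ u → g u = 0)
    (hlam : ∀ θ, HasDerivAt lam (lam' θ) θ) (hlam'c : Continuous lam')
    (hlamε : ∀ θ, |lam θ| ≤ ε) :
    ∫ θ in a..b, g (θ + lam θ) * (1 + lam' θ) = ∫ u in a..b, g u := by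
  have hT : ∀ θ, HasDerivAt (fun θ ↦ θ + lam θ) (1 + lam' θ) θ := fun θ ↦
    (hasDerivAt_id' θ).add (hlam θ)
  have hTmem : ∀ θ ∈ Icc a b, θ + lam θ ∈ Icc (a - 1) (b + 1) := by
    intro θ hθ
    have h1 := abs_le.1 (hlamε θ)
    have h2 := abs_le.1 (hlamε a)
    exact ⟨by linarith [hθ.1, h1.1], by linarith [hθ.2, h1.2]⟩
  have hTimg : (fun θ ↦ θ + lam θ) '' uIcc a b ⊆ Icc (a - 1) (b + 1) := by
    rw [uIcc_of_le hab]
    rintro _ ⟨θ, hθ, rfl⟩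
    exact hTmem θ hθ
  have hsub : ∫ θ in a..b, g (θ + lam θ) * (1 + lam' θ) =
      ∫ u in (a + lam a)..(b + lam b), g u := by
    have := intervalIntegral.integral_comp_mul_deriv' (f := fun θ ↦ θ + lam θ)
      (f' := fun θ ↦ 1 + lam' θ) (g := g) (a := a) (b := b)
      (fun θ _ ↦ hT θ) ((continuous_const.add hlam'c).continuousOn) (hg.mono hTimg)
    simpa [Function.comp] using this
  have hla := abs_le.1 (hlamε a)
  have hlb := abs_le.1 (hlamε b)
  have hε0 : 0 ≤ ε := (abs_nonneg _).trans (hlamε a)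
  have hii : ∀ c d, c ∈ Icc (a - 1) (b + 1) → d ∈ Icc (a - 1) (b + 1) →
      IntervalIntegrable g volume c d := fun c d hc hd ↦
    (hg.mono (uIcc_subset_Icc hc hd)).intervalIntegrable
  have hTa : a + lam a ∈ Icc (a - 1) (b + 1) := ⟨by linarith, by linarith⟩
  have hTb : b + lam b ∈ Icc (a - 1) (b + 1) := ⟨by linarith, by linarith⟩
  have haI : a ∈ Icc (a - 1) (b + 1) := ⟨by linarith, by linarith⟩
  have hbI : b ∈ Icc (a - 1) (b + 1) := ⟨by linarith, by linarith⟩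
  have h1 : ∫ u in (a + lam a)..a, g u = 0 := by
    rw [intervalIntegral.integral_congr (g := fun _ ↦ (0 : ℝ)) ?_]
    · simp
    · intro u hu
      apply hgs
      left
      rcases le_total (a + lam a) a with h | h
      · rw [uIcc_of_le h] at hu; linarith [hu.2]
      · rw [uIcc_of_ge h] at hu; linarith [hu.2]
  have h2 : ∫ u in b..(b + lam b), g u = 0 := by
    rw [intervalIntegral.integral_congr (g := fun _ ↦ (0 : ℝ)) ?_]
    · simp
    · intro u hu
      apply hgs
      right
      rcases le_total b (b + lam b) with h | h
      · rw [uIcc_of_le h] at hu; linarith [hu.1]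
      · rw [uIcc_of_ge h] at hu; linarith [hu.1]
  rw [hsub, ← intervalIntegral.integral_add_adjacent_intervals (hii _ _ hTa haI) (hii _ _ haI hTb),
    ← intervalIntegral.integral_add_adjacent_intervals (hii _ _ haI hbI) (hii _ _ hbI hTb),
    h1, h2, zero_add, add_zero]

/-- **First-order pushforward estimate (no inverse function).** If `T = id + λ` with
`|λ|, |λ'| ≤ ε ≤ 1`, `F` is continuous and bounded by `M` on `[a-1, b+1]`, and `ψ ∈ C¹` vanishes
off `[a+ε, b-ε]` with `|ψ| ≤ Mψ`, `|ψ'| ≤ Mψ'`, then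
`|∫ₐᵇ F(θ + λ θ) ψ(θ) dθ - ∫ₐᵇ F ψ| ≤ (b-a) M (Mψ + Mψ') ε`.  Proof: compare with
`∫ₐᵇ F(Tθ) ψ(Tθ) T'(θ) dθ = ∫_{Ta}^{Tb} F ψ = ∫ₐᵇ F ψ`. [folklore] -/
theorem integral_comp_perturb_sub_le {F lam lam' ψ ψ' : ℝ → ℝ} {a b ε M Mψ Mψ' : ℝ}
    (hab : a ≤ b) (hε1 : ε ≤ 1)
    (hF : ContinuousOn F (Icc (a - 1) (b + 1))) (hM : ∀ θ ∈ Icc (a - 1) (b + 1), |F θ| ≤ M)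
    (hψ : ∀ θ, HasDerivAt ψ (ψ' θ) θ)
    (hψs : ∀ θ, θ ≤ a + ε ∨ b - ε ≤ θ → ψ θ = 0)
    (hMψ : ∀ θ, |ψ θ| ≤ Mψ) (hMψ' : ∀ θ, |ψ' θ| ≤ Mψ')
    (hlam : ∀ θ, HasDerivAt lam (lam' θ) θ) (hlam'c : Continuous lam')
    (hlamε : ∀ θ, |lam θ| ≤ ε) (hlam'ε : ∀ θ, |lam' θ| ≤ ε) :
    |(∫ θ in a..b, F (θ + lam θ) * ψ θ) - ∫ θ in a..b, F θ * ψ θ| ≤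
      (b - a) * (M * (Mψ' + Mψ) * ε) := by
  have hψc : Continuous ψ := continuous_iff_continuousAt.2 fun θ ↦ (hψ θ).continuousAt
  have hlamc : Continuous lam := continuous_iff_continuousAt.2 fun θ ↦ (hlam θ).continuousAt
  have hTmem : ∀ θ ∈ Icc a b, θ + lam θ ∈ Icc (a - 1) (b + 1) := by
    intro θ hθ
    have h1 := abs_le.1 (hlamε θ)
    exact ⟨by linarith [hθ.1, h1.1], by linarith [hθ.2, h1.2]⟩
  have hFψ : ContinuousOn (fun u ↦ F u * ψ u) (Icc (a - 1) (b + 1)) := hF.mul hψc.continuousOn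
  have hends : ∫ θ in a..b, (F (θ + lam θ) * ψ (θ + lam θ)) * (1 + lam' θ) =
      ∫ u in a..b, F u * ψ u :=
    integral_comp_perturb_mul_deriv (g := fun u ↦ F u * ψ u) hab hε1 hFψ
      (fun u hu ↦ by rw [hψs u hu, mul_zero]) hlam hlam'c hlamε
  -- the difference of the two integrands is small pointwise
  have hbound : ∀ θ ∈ Set.uIoc a b,
      ‖F (θ + lam θ) * ψ θ - (F (θ + lam θ) * ψ (θ + lam θ)) * (1 + lam' θ)‖ ≤
        M * (Mψ' + Mψ) * ε := by
    intro θ hθ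
    rw [uIoc_of_le hab] at hθ
    have hθ' : θ ∈ Icc a b := ⟨hθ.1.le, hθ.2⟩
    have hFb : |F (θ + lam θ)| ≤ M := hM _ (hTmem θ hθ')
    have hM0 : 0 ≤ M := (abs_nonneg _).trans hFb
    have hψdiff : |ψ θ - ψ (θ + lam θ)| ≤ Mψ' * ε := by
      have := abs_sub_le_of_deriv_bound hψ hMψ' (θ + lam θ) θ
      have hMψ'0 : 0 ≤ Mψ' := (abs_nonneg _).trans (hMψ' 0)
      calc |ψ θ - ψ (θ + lam θ)| ≤ Mψ' * |θ - (θ + lam θ)| := this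
        _ = Mψ' * |lam θ| := by rw [show θ - (θ + lam θ) = -lam θ by ring, abs_neg]
        _ ≤ Mψ' * ε := mul_le_mul_of_nonneg_left (hlamε θ) hMψ'0
    have hkey : |ψ θ - ψ (θ + lam θ) * (1 + lam' θ)| ≤ (Mψ' + Mψ) * ε := by
      have h1 : ψ θ - ψ (θ + lam θ) * (1 + lam' θ) =
          (ψ θ - ψ (θ + lam θ)) - ψ (θ + lam θ) * lam' θ := by ring
      rw [h1]
      calc |(ψ θ - ψ (θ + lam θ)) - ψ (θ + lam θ) * lam' θ|
          ≤ |ψ θ - ψ (θ + lam θ)| + |ψ (θ + lam θ) * lam' θ| := abs_sub _ _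
        _ ≤ Mψ' * ε + Mψ * ε := by
            rw [abs_mul]
            exact add_le_add hψdiff (mul_le_mul (hMψ _) (hlam'ε θ) (abs_nonneg _)
              ((abs_nonneg _).trans (hMψ 0)))
        _ = (Mψ' + Mψ) * ε := by ring
    rw [Real.norm_eq_abs, show F (θ + lam θ) * ψ θ - F (θ + lam θ) * ψ (θ + lam θ) * (1 + lam' θ)
      = F (θ + lam θ) * (ψ θ - ψ (θ + lam θ) * (1 + lam' θ)) by ring, abs_mul]
    calc |F (θ + lam θ)| * |ψ θ - ψ (θ + lam θ) * (1 + lam' θ)|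
        ≤ M * ((Mψ' + Mψ) * ε) := mul_le_mul hFb hkey (abs_nonneg _) hM0
      _ = M * (Mψ' + Mψ) * ε := by ring
  -- conclude
  have hint1 : IntervalIntegrable (fun θ ↦ F (θ + lam θ) * ψ θ) volume a b := by
    refine ContinuousOn.intervalIntegrable ?_
    rw [uIcc_of_le hab]
    exact (hF.comp (continuous_id.add hlamc).continuousOn hTmem).mul hψc.continuousOn
  have hint2 : IntervalIntegrable (fun θ ↦ (F (θ + lam θ) * ψ (θ + lam θ)) * (1 + lam' θ))
      volume a b := by
    refine ContinuousOn.intervalIntegrable ?_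
    rw [uIcc_of_le hab]
    refine ((hF.comp (continuous_id.add hlamc).continuousOn hTmem).mul ?_).mul
      (continuous_const.add hlam'c).continuousOn
    exact (hψc.comp (continuous_id.add hlamc)).continuousOn
  rw [← hends, ← intervalIntegral.integral_sub hint1 hint2]
  have := intervalIntegral.norm_integral_le_of_norm_le_const hbound
  rw [Real.norm_eq_abs, abs_of_nonneg (by linarith : (0:ℝ) ≤ b - a)] at this
  linarith [this]

/-- First-order Taylor bound with a second-derivative remainder:
`|χ(θ+h) - χ(θ) - h χ'(θ)| ≤ M₂ |h|²`. [folklore] -/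
theorem taylor_one_bound {χ χ₁ χ₂ : ℝ → ℝ} {M₂ : ℝ} (h₁ : ∀ θ, HasDerivAt χ (χ₁ θ) θ)
    (h₂ : ∀ θ, HasDerivAt χ₁ (χ₂ θ) θ) (hM : ∀ θ, |χ₂ θ| ≤ M₂) (θ h : ℝ) :
    |χ (θ + h) - χ θ - h * χ₁ θ| ≤ M₂ * |h| ^ 2 := by
  have hM0 : 0 ≤ M₂ := (abs_nonneg _).trans (hM 0)
  set r : ℝ → ℝ := fun s ↦ χ (θ + s) - χ θ - s * χ₁ θ with hr
  set r₁ : ℝ → ℝ := fun s ↦ χ₁ (θ + s) - χ₁ θ with hr₁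
  have hr' : ∀ s, HasDerivAt r (r₁ s) s := by
    intro s
    have hh := (((h₁ (θ + s)).comp s ((hasDerivAt_id' s).const_add θ)).sub
      (hasDerivAt_const s (χ θ))).sub ((hasDerivAt_id' s).mul_const (χ₁ θ))
    refine hh.congr_deriv ?_
    simp only [hr₁]
    ring
  have hseg : ∀ s ∈ uIcc 0 h, |s| ≤ |h| := by
    intro s hs
    rcases le_total 0 h with hw | hw
    · rw [uIcc_of_le hw] at hs
      rw [abs_of_nonneg hs.1, abs_of_nonneg hw]; exact hs.2
    · rw [uIcc_of_ge hw] at hs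
      rw [abs_of_nonpos hs.2, abs_of_nonpos hw]; linarith [hs.1]
  have hb₁ : ∀ s ∈ uIcc 0 h, |r₁ s| ≤ M₂ * |h| := by
    intro s hs
    have := abs_sub_le_of_deriv_bound h₂ hM θ (θ + s)
    simp only [hr₁, add_sub_cancel_left] at this ⊢
    exact this.trans (mul_le_mul_of_nonneg_left (hseg s hs) hM0)
  have hb₀ : |r h| ≤ M₂ * |h| * |h| := by
    have h0 : (0 : ℝ) ∈ uIcc 0 h := left_mem_uIcc
    have := Convex.norm_image_sub_le_of_norm_hasDerivWithin_le (f := r) (f' := r₁)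
      (fun x _ ↦ (hr' x).hasDerivWithinAt) (fun x hx ↦ by
        simpa [Real.norm_eq_abs] using hb₁ x hx) (convex_uIcc 0 h) h0 right_mem_uIcc
    have hr0 : r 0 = 0 := by simp [hr]
    rw [hr0, sub_zero, Real.norm_eq_abs, Real.norm_eq_abs, sub_zero] at this
    exact this
  have : r h = χ (θ + h) - χ θ - h * χ₁ θ := rfl
  rw [← this]
  calc |r h| ≤ M₂ * |h| * |h| := hb₀
    _ = M₂ * |h| ^ 2 := by ring

/-- **Second-order pushforward estimate (no inverse function).** If `T = id + λ` with `λ` and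
its first three derivatives bounded by `ε ≤ 1`, `F` is continuous and bounded by `M` on
`[a-1, b+1]`, and `ψ ∈ C³` with `ψ, ψ'` vanishing off `[a+ε, b-ε]` and derivatives up to order
three bounded by `S`, then
`|∫ₐᵇ F(θ + λ θ) ψ(θ) dθ - ∫ₐᵇ F (ψ - (λψ)')| ≤ 32 (b-a) M S ε²`.  Proof: compare with
`∫ₐᵇ F(Tθ) χ(Tθ) T'(θ) dθ = ∫ₐᵇ F χ` for `χ = ψ - (λψ)'`; pointwise
`ψ - χ(T)(1+λ') = O(ε²)`. [folklore] -/
theorem integral_comp_perturb_sub_second_le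
    {F lam lam₁ lam₂ lam₃ ψ ψ₁ ψ₂ ψ₃ : ℝ → ℝ} {a b ε M S : ℝ}
    (hab : a ≤ b) (hε1 : ε ≤ 1)
    (hF : ContinuousOn F (Icc (a - 1) (b + 1))) (hM : ∀ θ ∈ Icc (a - 1) (b + 1), |F θ| ≤ M)
    (hψ : ∀ θ, HasDerivAt ψ (ψ₁ θ) θ) (hψ₁ : ∀ θ, HasDerivAt ψ₁ (ψ₂ θ) θ)
    (hψ₂ : ∀ θ, HasDerivAt ψ₂ (ψ₃ θ) θ)
    (hψs : ∀ θ, θ ≤ a + ε ∨ b - ε ≤ θ → ψ θ = 0) (hψ₁s : ∀ θ, θ ≤ a + ε ∨ b - ε ≤ θ → ψ₁ θ = 0)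
    (hS : ∀ θ, |ψ θ| ≤ S) (hS₁ : ∀ θ, |ψ₁ θ| ≤ S) (hS₂ : ∀ θ, |ψ₂ θ| ≤ S)
    (hS₃ : ∀ θ, |ψ₃ θ| ≤ S)
    (hlam : ∀ θ, HasDerivAt lam (lam₁ θ) θ) (hlam₁ : ∀ θ, HasDerivAt lam₁ (lam₂ θ) θ)
    (hlam₂ : ∀ θ, HasDerivAt lam₂ (lam₃ θ) θ)
    (hε : ∀ θ, |lam θ| ≤ ε) (hε₁ : ∀ θ, |lam₁ θ| ≤ ε) (hε₂ : ∀ θ, |lam₂ θ| ≤ ε)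
    (hε₃ : ∀ θ, |lam₃ θ| ≤ ε) :
    |(∫ θ in a..b, F (θ + lam θ) * ψ θ) -
        ∫ θ in a..b, F θ * (ψ θ - (lam₁ θ * ψ θ + lam θ * ψ₁ θ))| ≤
      (b - a) * (32 * M * S * ε ^ 2) := by
  have hε0 : 0 ≤ ε := (abs_nonneg _).trans (hε 0)
  have hS0 : 0 ≤ S := (abs_nonneg _).trans (hS 0)
  have hψc : Continuous ψ := continuous_iff_continuousAt.2 fun θ ↦ (hψ θ).continuousAt
  have hlamc : Continuous lam := continuous_iff_continuousAt.2 fun θ ↦ (hlam θ).continuousAt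
  have hlam₁c : Continuous lam₁ := continuous_iff_continuousAt.2 fun θ ↦ (hlam₁ θ).continuousAt
  -- `χ = ψ - (λψ)'` and its first two derivatives
  set χ : ℝ → ℝ := fun θ ↦ ψ θ - (lam₁ θ * ψ θ + lam θ * ψ₁ θ) with hχ
  set χ₁ : ℝ → ℝ := fun θ ↦ ψ₁ θ - (lam₂ θ * ψ θ + 2 * lam₁ θ * ψ₁ θ + lam θ * ψ₂ θ) with hχ₁
  set χ₂ : ℝ → ℝ := fun θ ↦
    ψ₂ θ - (lam₃ θ * ψ θ + 3 * lam₂ θ * ψ₁ θ + 3 * lam₁ θ * ψ₂ θ + lam θ * ψ₃ θ) with hχ₂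
  have hχ' : ∀ θ, HasDerivAt χ (χ₁ θ) θ := by
    intro θ
    have hh := (hψ θ).sub (((hlam₁ θ).mul (hψ θ)).add ((hlam θ).mul (hψ₁ θ)))
    refine hh.congr_deriv ?_
    simp only [hχ₁]; ring
  have hχ₁' : ∀ θ, HasDerivAt χ₁ (χ₂ θ) θ := by
    intro θ
    have hh := (hψ₁ θ).sub ((((hlam₂ θ).mul (hψ θ)).add
      (((hlam₁ θ).const_mul 2).mul (hψ₁ θ))).add ((hlam θ).mul (hψ₂ θ)))
    refine hh.congr_deriv ?_
    simp only [hχ₂]; ring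
  have hχc : Continuous χ := continuous_iff_continuousAt.2 fun θ ↦ (hχ' θ).continuousAt
  -- products of a small factor and a bounded factor
  have hprod : ∀ {x y Bx By : ℝ}, |x| ≤ Bx → |y| ≤ By → 0 ≤ Bx → |x * y| ≤ Bx * By := by
    intro x y Bx By hx hy hBx
    rw [abs_mul]; exact mul_le_mul hx hy (abs_nonneg _) hBx
  -- bounds for `χ₁`, `χ₂`
  have hb : ∀ θ, |χ₁ θ| ≤ 8 * S ∧ |χ₂ θ| ≤ 9 * S := by
    intro θ
    have q1 := abs_le.1 (hprod ((hε₂ θ).trans hε1) (hS θ) zero_le_one)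
    have q2 := abs_le.1 (hprod ((hε₁ θ).trans hε1) (hS₁ θ) zero_le_one)
    have q3 := abs_le.1 (hprod ((hε θ).trans hε1) (hS₂ θ) zero_le_one)
    have q4 := abs_le.1 (hprod ((hε₃ θ).trans hε1) (hS θ) zero_le_one)
    have q5 := abs_le.1 (hprod ((hε₂ θ).trans hε1) (hS₁ θ) zero_le_one)
    have q6 := abs_le.1 (hprod ((hε₁ θ).trans hε1) (hS₂ θ) zero_le_one)
    have q7 := abs_le.1 (hprod ((hε θ).trans hε1) (hS₃ θ) zero_le_one)
    have s1 := abs_le.1 (hS₁ θ); have s2 := abs_le.1 (hS₂ θ)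
    constructor
    · rw [abs_le]; simp only [hχ₁]; constructor <;> linarith
    · rw [abs_le]; simp only [hχ₂]; constructor <;> linarith
  -- Taylor of `χ` at first order
  have htay : ∀ θ, |χ (θ + lam θ) - χ θ - lam θ * χ₁ θ| ≤ 9 * S * ε ^ 2 := by
    intro θ
    have h1 := taylor_one_bound hχ' hχ₁' (fun θ ↦ (hb θ).2) θ (lam θ)
    refine h1.trans ?_
    have h2 : |lam θ| ^ 2 ≤ ε ^ 2 := pow_le_pow_left₀ (abs_nonneg _) (hε θ) 2
    nlinarith
  -- pointwise bound on `D = ψ - χ(T)(1 + λ')`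
  have hD : ∀ θ, |ψ θ - χ (θ + lam θ) * (1 + lam₁ θ)| ≤ 32 * S * ε ^ 2 := by
    intro θ
    set ρ : ℝ := χ (θ + lam θ) - χ θ - lam θ * χ₁ θ with hρ
    have hρb : |ρ| ≤ 9 * S * ε ^ 2 := htay θ
    have key : ψ θ - χ (θ + lam θ) * (1 + lam₁ θ) =
        (lam θ * lam₂ θ * ψ θ + 2 * (lam θ * lam₁ θ * ψ₁ θ) + lam θ * lam θ * ψ₂ θ +
          lam₁ θ * lam₁ θ * ψ θ + lam θ * lam₁ θ * ψ₁ θ) -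
          lam θ * lam₁ θ * χ₁ θ - ρ * (1 + lam₁ θ) := by
      simp only [hρ, hχ, hχ₁]; ring
    rw [key]
    have hεε : 0 ≤ ε * ε := by positivity
    have t1 : |lam θ * lam₂ θ| ≤ ε * ε := hprod (hε θ) (hε₂ θ) hε0
    have t2 : |lam θ * lam₁ θ| ≤ ε * ε := hprod (hε θ) (hε₁ θ) hε0
    have t3 : |lam θ * lam θ| ≤ ε * ε := hprod (hε θ) (hε θ) hε0
    have t4 : |lam₁ θ * lam₁ θ| ≤ ε * ε := hprod (hε₁ θ) (hε₁ θ) hε0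
    have v1 := abs_le.1 (hprod t1 (hS θ) hεε)
    have v2 := abs_le.1 (hprod t2 (hS₁ θ) hεε)
    have v3 := abs_le.1 (hprod t3 (hS₂ θ) hεε)
    have v4 := abs_le.1 (hprod t4 (hS θ) hεε)
    have v5 := abs_le.1 (hprod t2 (hb θ).1 hεε)
    have h1l : |1 + lam₁ θ| ≤ 2 := by
      calc |1 + lam₁ θ| ≤ |1| + |lam₁ θ| := abs_add_le _ _
        _ ≤ 1 + 1 := by rw [abs_one]; exact add_le_add le_rfl ((hε₁ θ).trans hε1)
        _ = 2 := by norm_num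
    have v6 := abs_le.1 (hprod hρb h1l (by positivity))
    have hε2 : ε * ε = ε ^ 2 := by ring
    rw [abs_le]
    constructor <;> nlinarith
  -- the comparison integral
  have hTmem : ∀ θ ∈ Icc a b, θ + lam θ ∈ Icc (a - 1) (b + 1) := by
    intro θ hθ
    have h1 := abs_le.1 (hε θ)
    exact ⟨by linarith [hθ.1, h1.1], by linarith [hθ.2, h1.2]⟩
  have hFχ : ContinuousOn (fun u ↦ F u * χ u) (Icc (a - 1) (b + 1)) := hF.mul hχc.continuousOn
  have hχs : ∀ u, u ≤ a + ε ∨ b - ε ≤ u → χ u = 0 := by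
    intro u hu; simp only [hχ, hψs u hu, hψ₁s u hu]; ring
  have hends : ∫ θ in a..b, (F (θ + lam θ) * χ (θ + lam θ)) * (1 + lam₁ θ) =
      ∫ u in a..b, F u * χ u :=
    integral_comp_perturb_mul_deriv (g := fun u ↦ F u * χ u) hab hε1 hFχ
      (fun u hu ↦ by rw [hχs u hu, mul_zero]) hlam hlam₁c hε
  have hbound : ∀ θ ∈ Set.uIoc a b,
      ‖F (θ + lam θ) * ψ θ - (F (θ + lam θ) * χ (θ + lam θ)) * (1 + lam₁ θ)‖ ≤
        32 * M * S * ε ^ 2 := by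
    intro θ hθ
    rw [uIoc_of_le hab] at hθ
    have hθ' : θ ∈ Icc a b := ⟨hθ.1.le, hθ.2⟩
    have hFb : |F (θ + lam θ)| ≤ M := hM _ (hTmem θ hθ')
    have hM0 : 0 ≤ M := (abs_nonneg _).trans hFb
    rw [Real.norm_eq_abs, show F (θ + lam θ) * ψ θ - F (θ + lam θ) * χ (θ + lam θ) * (1 + lam₁ θ)
      = F (θ + lam θ) * (ψ θ - χ (θ + lam θ) * (1 + lam₁ θ)) by ring, abs_mul]
    calc |F (θ + lam θ)| * |ψ θ - χ (θ + lam θ) * (1 + lam₁ θ)|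
        ≤ M * (32 * S * ε ^ 2) := mul_le_mul hFb (hD θ) (abs_nonneg _) hM0
      _ = 32 * M * S * ε ^ 2 := by ring
  have hint1 : IntervalIntegrable (fun θ ↦ F (θ + lam θ) * ψ θ) volume a b := by
    refine ContinuousOn.intervalIntegrable ?_
    rw [uIcc_of_le hab]
    exact (hF.comp (continuous_id.add hlamc).continuousOn hTmem).mul hψc.continuousOn
  have hint2 : IntervalIntegrable (fun θ ↦ (F (θ + lam θ) * χ (θ + lam θ)) * (1 + lam₁ θ))
      volume a b := by
    refine ContinuousOn.intervalIntegrable ?_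
    rw [uIcc_of_le hab]
    refine ((hF.comp (continuous_id.add hlamc).continuousOn hTmem).mul ?_).mul
      (continuous_const.add hlam₁c).continuousOn
    exact (hχc.comp (continuous_id.add hlamc)).continuousOn
  have hχeq : (fun θ ↦ F θ * (ψ θ - (lam₁ θ * ψ θ + lam θ * ψ₁ θ))) = fun u ↦ F u * χ u := rfl
  rw [hχeq, ← hends, ← intervalIntegral.integral_sub hint1 hint2]
  have := intervalIntegral.norm_integral_le_of_norm_le_const hbound
  rw [Real.norm_eq_abs, abs_of_nonneg (by linarith : (0:ℝ) ≤ b - a)] at this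
  linarith [this]

end Pushforward

/-- **Second-order pushforward estimate** (registered glue sub-goal of stmt-CriticalPhenomena-0746,
STUB C part C1): see `Pushforward.integral_comp_perturb_sub_second_le`. [folklore] -/
theorem pushforward_second_order : ∀ {F lam lam₁ lam₂ lam₃ ψ ψ₁ ψ₂ ψ₃ : ℝ → ℝ} {a b ε M S : ℝ}, a ≤ b → ε ≤ 1 → ContinuousOn F (Icc (a - 1) (b + 1)) → (∀ θ ∈ Icc (a - 1) (b + 1), |F θ| ≤ M) → (∀ θ, HasDerivAt ψ (ψ₁ θ) θ) → (∀ θ, HasDerivAt ψ₁ (ψ₂ θ) θ) → (∀ θ, HasDerivAt ψ₂ (ψ₃ θ) θ) → (∀ θ, θ ≤ a + ε ∨ b - ε ≤ θ → ψ θ = 0) → (∀ θ, θ ≤ a + ε ∨ b - ε ≤ θ → ψ₁ θ = 0) → (∀ θ, |ψ θ| ≤ S) → (∀ θ, |ψ₁ θ| ≤ S) → (∀ θ, |ψ₂ θ| ≤ S) → (∀ θ, |ψ₃ θ| ≤ S) → (∀ θ, HasDerivAt lam (lam₁ θ) θ) → (∀ θ, HasDerivAt lam₁ (lam₂ θ)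 θ) → (∀ θ, HasDerivAt lam₂ (lam₃ θ) θ) → (∀ θ, |lam θ| ≤ ε) → (∀ θ, |lam₁ θ| ≤ ε) → (∀ θ, |lam₂ θ| ≤ ε) → (∀ θ, |lam₃ θ| ≤ ε) → |(∫ θ in a..b, F (θ + lam θ) * ψ θ) - ∫ θ in a..b, F θ * (ψ θ - (lam₁ θ * ψ θ + lam θ * ψ₁ θ))| ≤ (b - a) * (32 * M * S * ε ^ 2) :=
  fun hab hε1 hF hM hψ hψ₁ hψ₂ hψs hψ₁s hS hS₁ hS₂ hS₃ hlam hlam₁ hlam₂ hε hε₁ hε₂ hε₃ ↦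
    Pushforward.integral_comp_perturb_sub_second_le hab hε1 hF hM hψ hψ₁ hψ₂ hψs hψ₁s hS hS₁ hS₂
      hS₃ hlam hlam₁ hlam₂ hε hε₁ hε₂ hε₃

end Summit.CriticalPhenomena.CardyFormulaZ2.Cruxes.CardyRigidity.CrossingMartingale

end
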